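import Summits.QuantumFields.YangMills.Theorems.BalabanUVNodesN11Sect3SupplyChainDefs
import Summits.QuantumFields.YangMills.Theorems.BalabanUVNodesN11GaussianCertificateBgRead

/-!
# DAG node N11 — BOREL 𝐁-TERMS ALONG dag-n11-e's WITNESS CHAIN: the supplier's responses having jointly Borel boundary terms (`SupplierBorel`) makes every chain witness's
# boundary terms jointly Borel (the splices are pointwise selections of old ∕ new ∕ zero values), and then — at any parameter of the Gaussian certificate class — dag-n11-d's
# door (d4) gives, from `ChainFormAt θ p σ k`, the no-expansion 𝐓-step of level `k` from the reading-line primitives ONLY (no term row, no (K0b) row, no pin)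

HEADER — WORK-UNIT METADATA.  Cell `pub-ymgap`, YM-PLAN Track A (D-0062 ∕ D-0149 width seats), seat `pub-ymgap-dag-n11-w1` (g0; WIDTH SEAT 1 of 4 on NODE n11 [B14]),
route `BalabanUVNodes` rev 25, item K1⁷ `StabilityBAtRecordR13SepCoPH` = stmt-QuantumFields-20542; DEFINITION lane (`--kind definition --supports 20542 --as helper`), count-neutral.
dag-n11-e g16's HAND-OUT W1-X1 «BorelB ALONG THE WITNESS CHAIN» (pub-ymgap INBOX 2026-08-28T01:38Z).  [III] = [Balaban1988Convergent].  Over dag-n11-e's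
`…N11Sect3SupplyChainDefs` (`Sect3Supplier`, `baseWitness`, `chainWitness`, `spliceTermsB`; `isFluctLocal_chainWitness` is the template), `…Sect3SupplySpliceDefs ∕ …OwnBoundary`
(`graftAbove`, `zeroRB`, `dropBFrom`, `graftAboveB`), and this seat's p593789 `…N11GaussianCertificateBgRead` (★★★★ `exists_local_witness_clause_succ_of_gaussCert_of_borelB_of_bgRead`,
over dag-n11-d's p591695 ∕ p591971).

WHAT THIS FILE DEFINES ∕ PROVES (2 `def`, theorems otherwise; 0 `sorry`; nothing of Bałaban asserted).
§1 `SupplierBorel θ p σ` — every response of the supplier along its own chain has boundary terms `𝐁^{(j)}(X, ι U, (S′, A))` jointly Borel in `(U, A)` (dag-n11-d's `hBt` shape,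
   the ONE law (d4) asks of named terms); `BaseBorel θ p` — the same for the level-0 witness `baseWitness θ p` (LOCATED: `baseWitness` is a `Classical.choose`, so its level-0
   terms are opaque; def-T's own level-0 witness has ZERO terms (`hasSect2FormAEZS_zero_of_bg_readsScaleZero`), for which this is `measurable_const` — question (Q1) to dag-n11-e
   on the bus: make the base explicit, or weaken `hBt` to `1 ≤ j`).
§2 Borel-ness is preserved by the splice primitives (`borelB_graftAbove ∕ _zeroRB ∕ _dropBFrom ∕ _graftAboveB`, pointwise `if`s) ⇒ ★ `borelB_spliceTermsB` ⇒ ★★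
   `borelB_chainWitness_of_supplierBorel` (induction on the level, as `isFluctLocal_chainWitness`).
§3 ★★★ `exists_truncWitness_clause_of_chainFormAt_of_gaussCert_of_supplierBorel_of_bgRead`: at any `θ` of the Gaussian class, from the chain's inductive hypothesis at level `k`
   (`HasSect2FormAtZS` of `ρ_k` at `chainWitness θ p σ k`, i.e. dag-n11-e's `ChainFormAt θ p σ k` unfolded) and `SupplierBorel` + `BaseBorel` + the supplier's locality: ONE
   `k`-local law-abiding witness (dag-n11-d's (d1)+(d4) truncation of the chain's) whose no-expansion 𝐓-image clause holds at EVERY no-expansion history — from `RegOn`,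
   `BgProvisoΛ` over the reading support and the run's window ONLY.  (The clause for the chain's OWN terms — dag-n11-e's `NoExpansionClauseFor … (chainWitness k)` — needs in
   addition a slot transfer truncated ↦ named at the new history, question (Q2) on the bus; NOT claimed here.)

HONEST FRAMING.  Helper ∕ definition lane of K1⁷; two predicates + kernel bookkeeping + one composition; `RegOn`, `BgProvisoΛ`, the window, `SupplierBorel`, `BaseBorel` and the
supplier's locality are DISPLAYED; a Gaussian certificate carries a RANGE value of `quad` (no-expansion analysis only), NOT node00-def-K0b's value of record; nothing of Bałaban
asserted.  N11 NOT discharged; K1⁷ NOT closed; counts unmoved (typed 28∕28 · discharged 5∕27).  R4 closes only the conditional finite-𝕋⁴ rung `BalabanLadder.UV` of one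
programme at fixed `ε = L^{−K}` — NOT ℝ⁴, NOT OS, NOT a mass gap, NOT Clay.  No `sorry`, `axiom`, `instance`, `notation`.
Sources (SHAPE only): [III] Theorem p.245, Thm 1 p.262, §3 p.279, (2.27) p.259, (2.40)–(2.41) p.261, (3.24)–(3.25) p.270.
-/

noncomputable section

open MeasureTheory
open scoped BigOperators ENNReal NNReal Matrix.Norms.L2Operator

namespace Summit.QuantumFields.YangMills.Theorems.BalabanUVNodesN11Sect3SupplyChainBorelB

open Literature.MathematicalPhysics.QuantumFieldTheory.Balaban1983to89 T4Continuum Node00 Node00.Tk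
open B15DeterminingSets B8Eq17ClassAkV1 Step
open B10Eq42TorusConstraint (bondsIn)
open BalabanUVNodesN11HistoryPinnedResidualDefs (ZhPinOfRecord₁₃)
open BalabanUVNodesN11FluctTruncationDefs (IsFluctLocal)
open BalabanUVNodesN11Sect3SupplySpliceDefs (graftAbove zeroRB dropBFrom)
open BalabanUVNodesN11Sect3SupplySpliceOwnBoundary (graftAboveB)
open BalabanUVNodesN11Sect3SupplyChainDefs
open BalabanUVNodesN11GaussianCertificateBgRead (exists_local_witness_clause_succ_of_gaussCert_of_borelB_of_bgRead)

variable {F : T4Family} {N : ℕ} [NeZero N]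

/-! ## §1  The one law (d4) asks of named terms: jointly Borel boundary terms — for the supplier's responses and for the base -/

section Defs

variable (θ : Stage13HParams F N) (p : B12.RunParams)

/-- **THE SUPPLIER's BOUNDARY TERMS ARE JOINTLY BOREL** along its own chain: for every level `k`, history `s₀` of length `k+1`, branch value `S′`, scale `j` and domain `X`, the
response's `𝐁^{(j)}(X, ι U, (S′, A))` is measurable in `(U, A)` (dag-n11-d's `hBt` shape of `…SpaceTruncationBorelB`; true for explicitly constructed terms).  Nothing claimed.
[cite: Balaban1988Convergent, (2.40)–(2.41) p.261, §3 p.279 (bookkeeping)] -/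
def SupplierBorel (σ : Sect3Supplier θ p) : Prop :=
  ∀ (k : ℕ) (s₀ : SeqOfRecord F θ.ν θ.τ9.M (gOfRecord₁₃ F N θ.toStage13Params p) p.K (k + 1)) (S' : ℕ → Set (Site (F.P p.K) 0)) (j : ℕ)
    (X : (Sect2.domSys (F.P p.K) θ.τ9.M j).Dom),
    Measurable (fun q : GaugeField (F.P p.K) 0 (SU N) × MSFluct (F.P p.K) (FluctV N) =>
      ((σ k (chainWitness θ p σ k).1 (chainWitness θ p σ k).2).1 s₀).B j X (Sect2.ofBackgroundC (settingOfRecord₁₃ F N θ.toStage13Params p).ι q.1) (S', q.2))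

/-- **THE BASE WITNESS's BOUNDARY TERMS ARE JOINTLY BOREL** — LOCATED: dag-n11-e's `baseWitness θ p` is a `Classical.choose`, so this is a genuine hypothesis on an opaque
object; def-T's own level-0 witness has ZERO term values, for which it is `measurable_const` (question (Q1) to dag-n11-e). [cite: Balaban1988Convergent, Thm 1 p.262 (bookkeeping)] -/
def BaseBorel (θ : Stage13HParams F N) (p : B12.RunParams) : Prop :=
  ∀ (s₀ : SeqOfRecord F θ.ν θ.τ9.M (gOfRecord₁₃ F N θ.toStage13Params p) p.K 0) (S' : ℕ → Set (Site (F.P p.K) 0)) (j : ℕ) (X : (Sect2.domSys (F.P p.K) θ.τ9.M j).Dom),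
    Measurable (fun q : GaugeField (F.P p.K) 0 (SU N) × MSFluct (F.P p.K) (FluctV N) =>
      ((baseWitness θ p).1 s₀).B j X (Sect2.ofBackgroundC (settingOfRecord₁₃ F N θ.toStage13Params p).ι q.1) (S', q.2))

end Defs

/-! ## §2  The splice primitives and the chain preserve joint Borel-ness of the boundary terms -/

section Splice

variable {θ : Stage13HParams F N} {p : B12.RunParams}

/-- `graftAbove k t u` selects `t.B` or `u.B` by the scale: Borel if both are. [cite: Balaban1988Convergent, (3.25) p.270 (bookkeeping)] -/
theorem borelB_graftAbove (k : ℕ) {t u : Sect2.TermValues (F.P p.K) (MatA N) (FluctV N) θ.τ9.M} (S' : ℕ → Set (Site (F.P p.K) 0)) (j : ℕ)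
    (X : (Sect2.domSys (F.P p.K) θ.τ9.M j).Dom)
    (ht : Measurable (fun q : GaugeField (F.P p.K) 0 (SU N) × MSFluct (F.P p.K) (FluctV N) => t.B j X (Sect2.ofBackgroundC (settingOfRecord₁₃ F N θ.toStage13Params p).ι q.1) (S', q.2)))
    (hu : Measurable (fun q : GaugeField (F.P p.K) 0 (SU N) × MSFluct (F.P p.K) (FluctV N) => u.B j X (Sect2.ofBackgroundC (settingOfRecord₁₃ F N θ.toStage13Params p).ι q.1) (S', q.2))) :
    Measurable (fun q : GaugeField (F.P p.K) 0 (SU N) × MSFluct (F.P p.K) (FluctV N) =>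
      (graftAbove k t u).B j X (Sect2.ofBackgroundC (settingOfRecord₁₃ F N θ.toStage13Params p).ι q.1) (S', q.2)) := by
  show Measurable (fun q : GaugeField (F.P p.K) 0 (SU N) × MSFluct (F.P p.K) (FluctV N) =>
    if j ≤ k then t.B j X (Sect2.ofBackgroundC (settingOfRecord₁₃ F N θ.toStage13Params p).ι q.1) (S', q.2)
      else u.B j X (Sect2.ofBackgroundC (settingOfRecord₁₃ F N θ.toStage13Params p).ι q.1) (S', q.2))
  by_cases hj : j ≤ k
  · simp only [if_pos hj]; exact ht
  · simp only [if_neg hj]; exact hu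

/-- `zeroRB u` has zero boundary terms: Borel. [cite: Balaban1988Convergent, (3.25) p.270 (bookkeeping)] -/
theorem borelB_zeroRB (u : Sect2.TermValues (F.P p.K) (MatA N) (FluctV N) θ.τ9.M) (S' : ℕ → Set (Site (F.P p.K) 0)) (j : ℕ) (X : (Sect2.domSys (F.P p.K) θ.τ9.M j).Dom) :
    Measurable (fun q : GaugeField (F.P p.K) 0 (SU N) × MSFluct (F.P p.K) (FluctV N) =>
      (zeroRB u).B j X (Sect2.ofBackgroundC (settingOfRecord₁₃ F N θ.toStage13Params p).ι q.1) (S', q.2)) :=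
  measurable_const

/-- `dropBFrom k t` selects `t.B` or `0` by the scale: Borel if `t.B` is. [cite: Balaban1988Convergent, (2.40)–(2.41) p.261 (bookkeeping)] -/
theorem borelB_dropBFrom (k : ℕ) {t : Sect2.TermValues (F.P p.K) (MatA N) (FluctV N) θ.τ9.M} (S' : ℕ → Set (Site (F.P p.K) 0)) (j : ℕ) (X : (Sect2.domSys (F.P p.K) θ.τ9.M j).Dom)
    (ht : Measurable (fun q : GaugeField (F.P p.K) 0 (SU N) × MSFluct (F.P p.K) (FluctV N) => t.B j X (Sect2.ofBackgroundC (settingOfRecord₁₃ F N θ.toStage13Params p).ι q.1) (S', q.2))) :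
    Measurable (fun q : GaugeField (F.P p.K) 0 (SU N) × MSFluct (F.P p.K) (FluctV N) =>
      (dropBFrom k t).B j X (Sect2.ofBackgroundC (settingOfRecord₁₃ F N θ.toStage13Params p).ι q.1) (S', q.2)) := by
  show Measurable (fun q : GaugeField (F.P p.K) 0 (SU N) × MSFluct (F.P p.K) (FluctV N) =>
    if j < k then t.B j X (Sect2.ofBackgroundC (settingOfRecord₁₃ F N θ.toStage13Params p).ι q.1) (S', q.2) else 0)
  by_cases hj : j < k
  · simp only [if_pos hj]; exact ht
  · simp only [if_neg hj]; exact measurable_const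

/-- `graftAboveB k t u` selects `t.B` below `k` and `u.B` from `k` on: Borel if both are. [cite: Balaban1988Convergent, §3 p.279 (bookkeeping)] -/
theorem borelB_graftAboveB (k : ℕ) {t u : Sect2.TermValues (F.P p.K) (MatA N) (FluctV N) θ.τ9.M} (S' : ℕ → Set (Site (F.P p.K) 0)) (j : ℕ)
    (X : (Sect2.domSys (F.P p.K) θ.τ9.M j).Dom)
    (ht : Measurable (fun q : GaugeField (F.P p.K) 0 (SU N) × MSFluct (F.P p.K) (FluctV N) => t.B j X (Sect2.ofBackgroundC (settingOfRecord₁₃ F N θ.toStage13Params p).ι q.1) (S', q.2)))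
    (hu : Measurable (fun q : GaugeField (F.P p.K) 0 (SU N) × MSFluct (F.P p.K) (FluctV N) => u.B j X (Sect2.ofBackgroundC (settingOfRecord₁₃ F N θ.toStage13Params p).ι q.1) (S', q.2))) :
    Measurable (fun q : GaugeField (F.P p.K) 0 (SU N) × MSFluct (F.P p.K) (FluctV N) =>
      (graftAboveB k t u).B j X (Sect2.ofBackgroundC (settingOfRecord₁₃ F N θ.toStage13Params p).ι q.1) (S', q.2)) := by
  show Measurable (fun q : GaugeField (F.P p.K) 0 (SU N) × MSFluct (F.P p.K) (FluctV N) =>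
    if j < k then t.B j X (Sect2.ofBackgroundC (settingOfRecord₁₃ F N θ.toStage13Params p).ι q.1) (S', q.2)
      else u.B j X (Sect2.ofBackgroundC (settingOfRecord₁₃ F N θ.toStage13Params p).ι q.1) (S', q.2))
  by_cases hj : j < k
  · simp only [if_pos hj]; exact ht
  · simp only [if_neg hj]; exact hu

/-- **★ THE SPLICE PRESERVES JOINT BOREL-NESS OF THE BOUNDARY TERMS**: at every history `s′` of length `k+1` the spliced `𝐁^{(j)}` is the old one at `init s′`, the supplier's at `s′`,
or zero (the three branches of `spliceTermsB`). [cite: Balaban1988Convergent, (3.24)–(3.25) p.270, §3 p.279 (bookkeeping)] -/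
theorem borelB_spliceTermsB {k : ℕ} {t : SeqOfRecord F θ.ν θ.τ9.M (gOfRecord₁₃ F N θ.toStage13Params p) p.K k → Sect2.TermValues (F.P p.K) (MatA N) (FluctV N) θ.τ9.M}
    {tnew : SeqOfRecord F θ.ν θ.τ9.M (gOfRecord₁₃ F N θ.toStage13Params p) p.K (k + 1) → Sect2.TermValues (F.P p.K) (MatA N) (FluctV N) θ.τ9.M}
    (s : SeqOfRecord F θ.ν θ.τ9.M (gOfRecord₁₃ F N θ.toStage13Params p) p.K (k + 1)) (S' : ℕ → Set (Site (F.P p.K) 0)) (j : ℕ) (X : (Sect2.domSys (F.P p.K) θ.τ9.M j).Dom)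
    (ht : Measurable (fun q : GaugeField (F.P p.K) 0 (SU N) × MSFluct (F.P p.K) (FluctV N) =>
      (t s.init).B j X (Sect2.ofBackgroundC (settingOfRecord₁₃ F N θ.toStage13Params p).ι q.1) (S', q.2)))
    (hn : Measurable (fun q : GaugeField (F.P p.K) 0 (SU N) × MSFluct (F.P p.K) (FluctV N) =>
      (tnew s).B j X (Sect2.ofBackgroundC (settingOfRecord₁₃ F N θ.toStage13Params p).ι q.1) (S', q.2))) :
    Measurable (fun q : GaugeField (F.P p.K) 0 (SU N) × MSFluct (F.P p.K) (FluctV N) =>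
      (spliceTermsB θ p k t tnew s).B j X (Sect2.ofBackgroundC (settingOfRecord₁₃ F N θ.toStage13Params p).ι q.1) (S', q.2)) := by
  classical
  unfold spliceTermsB
  split_ifs with hΩ h0
  · exact borelB_graftAbove k S' j X ht (borelB_zeroRB (tnew s) S' j X)
  · exact borelB_graftAbove k S' j X (borelB_dropBFrom k S' j X ht) (borelB_zeroRB (tnew s) S' j X)
  · exact borelB_graftAboveB k S' j X ht hn

/-- **★★ THE CHAIN WITNESS HAS JOINTLY BOREL BOUNDARY TERMS AT EVERY LEVEL** when the base has (`BaseBorel`, LOCATED) and every supplier response has (`SupplierBorel`):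
induction on the level exactly as dag-n11-e's `isFluctLocal_chainWitness`. [cite: Balaban1988Convergent, Thm 1 p.262, §3 p.279, (3.24)–(3.25) p.270 (bookkeeping)] -/
theorem borelB_chainWitness_of_supplierBorel (σ : Sect3Supplier θ p) (hbase : BaseBorel θ p) (hσ : SupplierBorel θ p σ) :
    ∀ (k : ℕ) (s₀ : SeqOfRecord F θ.ν θ.τ9.M (gOfRecord₁₃ F N θ.toStage13Params p) p.K k) (S' : ℕ → Set (Site (F.P p.K) 0)) (j : ℕ)
      (X : (Sect2.domSys (F.P p.K) θ.τ9.M j).Dom),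
      Measurable (fun q : GaugeField (F.P p.K) 0 (SU N) × MSFluct (F.P p.K) (FluctV N) =>
        ((chainWitness θ p σ k).1 s₀).B j X (Sect2.ofBackgroundC (settingOfRecord₁₃ F N θ.toStage13Params p).ι q.1) (S', q.2)) := by
  intro k
  induction k with
  | zero => exact fun s₀ S' j X => hbase s₀ S' j X
  | succ k ih => exact fun s S' j X => borelB_spliceTermsB s S' j X (ih s.init S' j X) (hσ k s S' j X)

end Splice

/-! ## §3  ★★★ At a Gaussian certificate: the no-expansion 𝐓-step of level `k` from the chain's inductive hypothesis — reading-line primitives only -/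

section Step

variable (θ : Stage13HParams F N) (p : B12.RunParams)

/-- **★★★ FROM THE CHAIN's INDUCTIVE HYPOTHESIS AT LEVEL `k` TO THE NO-EXPANSION 𝐓-STEP, AT A GAUSSIAN CERTIFICATE, FROM THE READING-LINE PRIMITIVES ONLY**: for `θ` of the Gaussian
class (certificate `ζ0`, A-fibre Gaussian `quad`) with core provisos, admissibility, the §2 signs, `k < K`, `1 ≤ M`, the run inside the window below `k`, a reading selector with
the residual's `RegOn` law and def-R's `BgProvisoΛ` over the reading support; a supplier `σ` whose responses are `(j+1)`-local and jointly Borel in their boundary terms, and a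
jointly Borel base (LOCATED): if the chain's level-`k` witness HAS the §2 form of `ρ_k` (dag-n11-e's `ChainFormAt θ p σ k`, unfolded), then some `k`-local law-abiding witness —
dag-n11-d's (d1)+(d4) truncation of it — satisfies the 𝐓-image clause at EVERY no-expansion history.  This seat's ★★★★ `…GaussianCertificateBgRead.…_of_borelB_of_bgRead` at the
chain's witness with `hBt` from §2.  (The clause FOR THE CHAIN's OWN TERMS needs a further slot transfer — bus question (Q2) — and is not claimed.)
[cite: Balaban1988Convergent, Theorem p.245, Thm 1 p.262, §3 p.279, (3.24)–(3.25) p.270, (2.10) p.256, (2.27)–(2.28) p.259] -/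
theorem exists_truncWitness_clause_of_chainFormAt_of_gaussCert_of_supplierBorel_of_bgRead
    (hζ : ∀ (p : B12.RunParams) (n : ℕ) (Ω Λ : ℕ → Set (Site (F.P p.K) 0)), (θ.Zh p n Ω Λ).ζ0 = (ZhPinOfRecord₁₃ θ.toStage13Params p Ω Λ).ζ0)
    (hq : ∀ (p : B12.RunParams) (n : ℕ) (Ω Λ : ℕ → Set (Site (F.P p.K) 0)) (j : ℕ) (Λ' : Set (Site (F.P p.K) 0)) (ω : MultiCfg (F.P p.K) (SU N) (FluctV N)),
      (θ.Zh p n Ω Λ).quad j Λ' ω = ∑ b ∈ (Set.toFinite (bondsIn j (Λ'ᶜ ∩ Ω (j + 1)))).toFinset, ‖(ω j).2 b‖ ^ 2)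
    (h : θ.Provisos₁₃CoPH F N) (hθ : θ.Admissible F N) (hpos : θ.s2.Pos) {k : ℕ} (hk : k < p.K) (hM : 1 ≤ θ.τ9.M)
    (hw : Step.InInterval θ.γ k (gOfRecord₁₃ F N θ.toStage13Params p)) (cR : ℝ)
    (Γr : SeqOfRecord F θ.ν θ.τ9.M (gOfRecord₁₃ F N θ.toStage13Params p) p.K k → ℕ → Set (Site (F.P p.K) 0) → Set (Site (F.P p.K) 0))
    (hreg : ∀ s₀, (θ.zhAt p s₀).RegOn F N (FluctV N) θ.ν cR p (gOfRecord₁₃ F N θ.toStage13Params p) (Γr s₀))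
    (hbg : BgProvisoΛ F N p.K (settingOfRecord₁₃ F N θ.toStage13Params p) (θ.Rz p.K) θ.τ9.M k
      (fun s₀ => {Wc | chiSeqOfRecord F N θ.ν θ.τ9.M (gOfRecord₁₃ F N θ.toStage13Params p) p.K k s₀ (Wc k) ≠ 0 ∧
        ∀ j, j < k → PlaqSmallOn (plaqsOf (pts j (Γr s₀ j (s₀.Ω (j + 1))ᶜ))) (cR * epsOfRecord θ.ν (gOfRecord₁₃ F N θ.toStage13Params p) j) (Wc j)})
      (UbgOfRecord₁₃CoP F N θ.toStage13Params p k))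
    (σ : Sect3Supplier θ p) (hbase : BaseBorel θ p) (hσB : SupplierBorel θ p σ)
    (hform : HasSect2FormAtZS F N (FluctV N) p.K (settingOfRecord₁₃ F N θ.toStage13Params p) k (θ.rzAt p) (WtOfRecord₁₃H F N θ p)
      (UbgOfRecord₁₃CoP F N θ.toStage13Params p k)
      (fun s u => Sect2.LawsRT (sect2TowerOfRecord F N (FluctV N) p.K (settingOfRecord₁₃ F N θ.toStage13Params p) (θ.rzAt p s) s u)
        (settingOfRecord₁₃ F N θ.toStage13Params p).lf k)
      (slotsOfRecord F N θ.ν θ.τ9 (EOfRecord₁₃ F N θ.toStage13Params) (wOfRecord₉ F N θ.toStage9Params) θ.ppSel p (gOfRecord₁₃ F N θ.toStage13Params p) k)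
      (chainWitness θ p σ k).1 (chainWitness θ p σ k).2) :
    ∃ (t : SeqOfRecord F θ.ν θ.τ9.M (gOfRecord₁₃ F N θ.toStage13Params p) p.K k → Sect2.TermValues (F.P p.K) (MatA N) (FluctV N) θ.τ9.M)
      (Ek : SeqOfRecord F θ.ν θ.τ9.M (gOfRecord₁₃ F N θ.toStage13Params p) p.K k → ℝ),
      HasSect2FormAtZS F N (FluctV N) p.K (settingOfRecord₁₃ F N θ.toStage13Params p) k (θ.rzAt p) (WtOfRecord₁₃H F N θ p)
          (UbgOfRecord₁₃CoP F N θ.toStage13Params p k)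
          (fun s₀ t₀ => Sect2.LawsRT (sect2TowerOfRecord F N (FluctV N) p.K (settingOfRecord₁₃ F N θ.toStage13Params p) (θ.rzAt p s₀) s₀ t₀)
            (settingOfRecord₁₃ F N θ.toStage13Params p).lf k)
          (slotsOfRecord F N θ.ν θ.τ9 (EOfRecord₁₃ F N θ.toStage13Params) (wOfRecord₉ F N θ.toStage9Params) θ.ppSel p
            (gOfRecord₁₃ F N θ.toStage13Params p) k) t Ek ∧
      (∀ s₀, IsFluctLocal k (t s₀)) ∧
      ∀ (s : SeqOfRecord F θ.ν θ.τ9.M (gOfRecord₁₃ F N θ.toStage13Params p) p.K (k + 1)), s.Ω (k + 1) = ∅ →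
        (slotsTOfRecord F N θ.ν θ.τ9 (EOfRecord₁₃ F N θ.toStage13Params) (wOfRecord₉ F N θ.toStage9Params) θ.ppSel p
            (gOfRecord₁₃ F N θ.toStage13Params p) (k + 1) s = 0 ∨
          ∀ᵐ V' ∂fieldMeasure (F.P p.K) (k + 1) (SU N),
            chiSeqOfRecord F N θ.ν θ.τ9.M (gOfRecord₁₃ F N θ.toStage13Params p) p.K (k + 1) s V' ≠ 0 →
              slotsTOfRecord F N θ.ν θ.τ9 (EOfRecord₁₃ F N θ.toStage13Params) (wOfRecord₉ F N θ.toStage9Params) θ.ppSel p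
                  (gOfRecord₁₃ F N θ.toStage13Params p) (k + 1) s V' =
                sect2Slot F N (FluctV N) p.K (settingOfRecord₁₃ F N θ.toStage13Params p) (θ.rzAt p s) (WtOfRecord₁₃H F N θ p s) s
                  (t s.init) (Ek s.init) (UbgOfRecord₁₃CoP F N θ.toStage13Params p (k + 1) s) V') :=
  exists_local_witness_clause_succ_of_gaussCert_of_borelB_of_bgRead θ p hζ hq h hθ hpos hk hM hw cR Γr hreg hbg (chainWitness θ p σ k).1 (chainWitness θ p σ k).2 hform
    (fun s₀ S' j X => borelB_chainWitness_of_supplierBorel σ hbase hσB k s₀ S' j X)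

end Step

end Summit.QuantumFields.YangMills.Theorems.BalabanUVNodesN11Sect3SupplyChainBorelB

end
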